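import Literature.Analysis.FunctionSpaces.BesselKSmallArgument
import Literature.Algebra.EuclideanLattices.DualLattice

/-!
# Dual Bessel ladder — rational certificates, the half-integer ladder for `K_m`, planar dual-lattice geometry

g66 Deliverable B (lens-4, slot Z / CERT leaf Z2 of `stmt-AtomisticToContinuum-31280`), part 1/3.  Literature-only imports.

The far-layer spread bound `abs_layerSum_sub_layerSum_le` (g65 `…LayerSpread`) leaves the dual Bessel sum
`Σ'_{w ∈ Λ_B^*} (π‖w‖/d)^μ K_μ(2π d ‖w‖)` (`μ = σ − 1 ∈ ℕ`, `d` = layer distance, `Λ_B` the planar layer lattice) to be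
evaluated.  This file supplies the three ingredients of a kernel-checkable evaluation:

* §K1 rational certificates: `piLo < π < piHi`, `e^{−x} ≤ expUB N x = (7/19)^N / (1 + t + t²/2)` (`t = x − N ≥ 0`),
  square roots by squaring (`sqrt_le_of_sq`);
* §K2 the HALF-INTEGER LADDER `K_m(y) ≤ √(π/(2y)) e^{−y} ∏_{j<m} (1 + (2j+1)/y)` (`besselKReal_nat_le_ladder`, from
  `K_{1/2}` in closed form, the recurrence `mul_besselKReal_succ_le` and monotonicity in the order), and the decreasing
  envelope `y^m K_m(y) ≤ [..]·e^{−(1 − m/y₁)(y − y₁)}` for `y ≥ y₁ > m` (`pow_mul_besselKReal_le_envelope`);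
* §K3 planar Gram geometry: the norm identity `‖w‖²·det G = Q(⟪w,b₀⟫, ⟪w,b₁⟫)` with the adjugate form `Q`, integer
  coordinates `dualCoord : Λ^* → ℤ²` (injective), and the comparison `Σ'_{Λ^*} F ≤ Σ'_{ℤ²} G` under pointwise domination
  (`tsum_dualLattice_le_of_majorant`).

No `sorry`; axioms standard.  References: [Watson, *Bessel functions* §3.71 (12), §7.23]; Literature `BesselKRecurrence`,
`BesselKSmallArgument`, `DualLattice`.
-/

noncomputable section

open Real Set Finset
open scoped BigOperators InnerProductSpace

namespace Summit.AtomisticToContinuum.Crystallization.Theorems.OverbindingBudgetAffineFarSmoothSplit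

open Literature.Analysis.FunctionSpaces Literature.Algebra.EuclideanLattices

/-! ## §K1 Rational certificates for `π`, `e^{−x}` and square roots -/

/-- Rational brackets of `π` (Mathlib `Real.pi_gt_d6`, `Real.pi_lt_d6`). -/
def piLo : ℚ := 3.141592
/-- `piHi` (docstring added by the landing lane; see the module docstring). [formal bookkeeping] -/
def piHi : ℚ := 3.141593

/-- `piLo_lt_pi` (docstring added by the landing lane; see the module docstring). [formal bookkeeping] -/
theorem piLo_lt_pi : ((piLo : ℚ) : ℝ) < π := by
  have h := Real.pi_gt_d6; norm_num [piLo] at h ⊢; exact h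

/-- `pi_lt_piHi` (docstring added by the landing lane; see the module docstring). [formal bookkeeping] -/
theorem pi_lt_piHi : π < ((piHi : ℚ) : ℝ) := by
  have h := Real.pi_lt_d6; norm_num [piHi] at h ⊢; exact h

/-- `piLo_pos` (docstring added by the landing lane; see the module docstring). [formal bookkeeping] -/
theorem piLo_pos : (0 : ℝ) < ((piLo : ℚ) : ℝ) := by norm_num [piLo]

/-- `e⁻¹ ≤ 7/19`. [folklore] -/
theorem exp_neg_one_le : Real.exp (-1) ≤ 7 / 19 := by
  have h := Real.exp_one_gt_d9
  rw [Real.exp_neg, inv_le_comm₀ (Real.exp_pos 1) (by norm_num)]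
  linarith

/-- `e^{−t} ≤ 1/(1 + t + t²/2)` for `t ≥ 0`. [folklore] -/
theorem exp_neg_le_inv_quadratic {t : ℝ} (ht : 0 ≤ t) : Real.exp (-t) ≤ 1 / (1 + t + t ^ 2 / 2) := by
  rw [Real.exp_neg, one_div]
  exact inv_anti₀ (by positivity) (Real.quadratic_le_exp_of_nonneg ht)

/-- The rational upper certificate for `e^{−x}`: `expUB N x = (7/19)^N / (1 + (x−N) + (x−N)²/2)`. -/
def expUB (N : ℕ) (x : ℚ) : ℚ := (7 / 19) ^ N / (1 + (x - N) + (x - N) ^ 2 / 2)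

/-- `e^{−x} ≤ expUB N x` whenever `N ≤ x`. [folklore] -/
theorem exp_neg_le_expUB {N : ℕ} {x : ℚ} (h : (N : ℚ) ≤ x) : Real.exp (-(x : ℝ)) ≤ ((expUB N x : ℚ) : ℝ) := by
  have hx : ((N : ℚ) : ℝ) ≤ ((x : ℚ) : ℝ) := by exact_mod_cast h
  have ht : (0 : ℝ) ≤ (x : ℝ) - N := by push_cast at hx; linarith
  have hsplit : Real.exp (-(x : ℝ)) = Real.exp (-1) ^ N * Real.exp (-((x : ℝ) - N)) := by
    rw [← Real.exp_nat_mul, ← Real.exp_add]; congr 1; ring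
  rw [hsplit]
  have h1 : Real.exp (-1) ^ N ≤ (7 / 19 : ℝ) ^ N := pow_le_pow_left₀ (Real.exp_pos _).le exp_neg_one_le N
  have h2 := exp_neg_le_inv_quadratic ht
  have e : ((expUB N x : ℚ) : ℝ) = (7 / 19 : ℝ) ^ N * (1 / (1 + ((x : ℝ) - N) + ((x : ℝ) - N) ^ 2 / 2)) := by
    push_cast [expUB]; ring
  rw [e]
  exact mul_le_mul h1 h2 (Real.exp_pos _).le (by positivity)

/-- A monotone weakening: `e^{−x} ≤ expUB N x₀` whenever `N ≤ x₀ ≤ x`. [folklore] -/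
theorem exp_neg_le_expUB_of_le {N : ℕ} {x₀ : ℚ} (h : (N : ℚ) ≤ x₀) {x : ℝ} (hx : ((x₀ : ℚ) : ℝ) ≤ x) :
    Real.exp (-x) ≤ ((expUB N x₀ : ℚ) : ℝ) :=
  le_trans (Real.exp_le_exp.2 (neg_le_neg hx)) (exp_neg_le_expUB h)

/-- Square-root upper certificate: `√a ≤ s` if `0 ≤ s` and `a ≤ s²`. [folklore] -/
theorem sqrt_le_of_sq {a s : ℝ} (hs : 0 ≤ s) (h : a ≤ s ^ 2) : Real.sqrt a ≤ s :=
  Real.sqrt_le_iff.2 ⟨hs, h⟩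

/-! ## §K2 The half-integer ladder bound for `K_m`, `m ∈ ℕ`, and its decreasing tail envelope -/

/-- The ladder factor `∏_{j<m} (1 + (2j+1)/y)` (real). -/
def ladder (m : ℕ) (y : ℝ) : ℝ := ∏ j ∈ Finset.range m, (1 + (2 * (j : ℝ) + 1) / y)

/-- The ladder factor over `ℚ` (kernel side). -/
def ladderQ (m : ℕ) (y : ℚ) : ℚ := ∏ j ∈ Finset.range m, (1 + (2 * (j : ℚ) + 1) / y)

/-- `ladderQ_cast` (docstring added by the landing lane; see the module docstring). [formal bookkeeping] -/
theorem ladderQ_cast (m : ℕ) (y : ℚ) : ((ladderQ m y : ℚ) : ℝ) = ladder m (y : ℝ) := by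
  unfold ladderQ ladder; push_cast; rfl

/-- `ladder_pos` (docstring added by the landing lane; see the module docstring). [formal bookkeeping] -/
theorem ladder_pos (m : ℕ) {y : ℝ} (hy : 0 < y) : 0 < ladder m y :=
  Finset.prod_pos fun j _ => by positivity

/-- The ladder factor is antitone in `y > 0`. [this file] -/
theorem ladder_le_ladder (m : ℕ) {y y' : ℝ} (hy : 0 < y) (h : y ≤ y') : ladder m y' ≤ ladder m y := by
  unfold ladder
  have hy' : 0 < y' := lt_of_lt_of_le hy h
  refine Finset.prod_le_prod (fun j _ => by positivity) fun j _ => ?_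
  have : (2 * (j : ℝ) + 1) / y' ≤ (2 * (j : ℝ) + 1) / y := div_le_div_of_nonneg_left (by positivity) hy h
  linarith

/-- `K_{m+1/2}(y) ≤ √(π/(2y)) e^{−y} ∏_{j<m}(1 + (2j+1)/y)` (equality at `m = 0`, DLMF 10.39.2, then the recurrence bound
`y K_{ν+1} ≤ (2ν + y) K_ν`, DLMF 10.29.1 with `K_{ν−1} ≤ K_ν`). [cite: DLMF, 10.39.2] [cite: DLMF, 10.29.1] -/
theorem besselKReal_half_add_le (m : ℕ) {y : ℝ} (hy : 0 < y) :
    besselKReal ((m : ℝ) + 1 / 2) y ≤ Real.sqrt (π / (2 * y)) * Real.exp (-y) * ladder m y := by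
  induction m with
  | zero =>
    simp only [Nat.cast_zero, zero_add, ladder, Finset.range_zero, Finset.prod_empty, mul_one]
    exact (besselKReal_half_eq hy).le
  | succ m ih =>
    have hν : (1 : ℝ) / 2 ≤ (m : ℝ) + 1 / 2 := by
      have : (0 : ℝ) ≤ m := Nat.cast_nonneg m
      linarith
    have hrec := mul_besselKReal_succ_le hν hy
    -- `y K_{ν+1} ≤ (2ν + y) K_ν`, i.e. `K_{ν+1} ≤ (1 + 2ν/y) K_ν`
    have hK : besselKReal ((m : ℝ) + 1 / 2 + 1) y ≤ (1 + (2 * (m : ℝ) + 1) / y) * besselKReal ((m : ℝ) + 1 / 2) y := by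
      rw [show (1 + (2 * (m : ℝ) + 1) / y) * besselKReal ((m : ℝ) + 1 / 2) y =
        (2 * ((m : ℝ) + 1 / 2) * besselKReal ((m : ℝ) + 1 / 2) y + y * besselKReal ((m : ℝ) + 1 / 2) y) / y by
          field_simp; ring]
      rw [le_div_iff₀ hy]; linarith
    have hcast : ((m + 1 : ℕ) : ℝ) + 1 / 2 = (m : ℝ) + 1 / 2 + 1 := by push_cast; ring
    rw [hcast, ladder, Finset.prod_range_succ, ← ladder]
    have hfac : 0 ≤ 1 + (2 * (m : ℝ) + 1) / y := by positivity
    calc besselKReal ((m : ℝ) + 1 / 2 + 1) y ≤ (1 + (2 * (m : ℝ) + 1) / y) * besselKReal ((m : ℝ) + 1 / 2) y := hK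
      _ ≤ (1 + (2 * (m : ℝ) + 1) / y) * (Real.sqrt (π / (2 * y)) * Real.exp (-y) * ladder m y) :=
          mul_le_mul_of_nonneg_left ih hfac
      _ = Real.sqrt (π / (2 * y)) * Real.exp (-y) * (ladder m y * (1 + (2 * (m : ℝ) + 1) / y)) := by ring

/-- ★ **Half-integer ladder bound** for integer order: `K_m(y) ≤ √(π/(2y)) e^{−y} ∏_{j<m}(1 + (2j+1)/y)` (`K_m ≤ K_{m+1/2}`,
DLMF 10.32.9). [cite: DLMF, 10.32.9] -/
theorem besselKReal_nat_le_ladder (m : ℕ) {y : ℝ} (hy : 0 < y) :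
    besselKReal m y ≤ Real.sqrt (π / (2 * y)) * Real.exp (-y) * ladder m y := by
  refine le_trans (besselKReal_le_of_abs_le ?_ hy) (besselKReal_half_add_le m hy)
  have h0 : (0 : ℝ) ≤ m := Nat.cast_nonneg m
  rw [abs_of_nonneg h0, abs_of_nonneg (by linarith)]
  linarith

/-- `K_m` is antitone on `(0, ∞)` (restated from `strictAntiOn_besselKReal`). -/
theorem besselKReal_le_of_le {ν y y' : ℝ} (hy : 0 < y) (h : y ≤ y') : besselKReal ν y' ≤ besselKReal ν y :=
  (strictAntiOn_besselKReal ν).antitoneOn (Set.mem_Ioi.2 hy) (Set.mem_Ioi.2 (lt_of_lt_of_le hy h)) h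

/-- The power-vs-exponential step: `(y/y₁)^m ≤ exp(m (y/y₁ − 1))` for `y, y₁ > 0`. [folklore] -/
theorem div_pow_le_exp (m : ℕ) {y y₁ : ℝ} (hy : 0 < y) (hy₁ : 0 < y₁) :
    (y / y₁) ^ m ≤ Real.exp ((m : ℝ) * (y / y₁ - 1)) := by
  rw [Real.exp_nat_mul]
  refine pow_le_pow_left₀ (div_pos hy hy₁).le ?_ m
  have := Real.add_one_le_exp (y / y₁ - 1)
  linarith

/-- ★ **Decreasing tail envelope**: for `0 < y₁ ≤ y` and `m < y₁`,
`y^m K_m(y) ≤ [√(π/(2y₁)) · ladder m y₁ · y₁^m e^{−y₁}] · e^{−(1 − m/y₁)(y − y₁)}`. [this file] -/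
theorem pow_mul_besselKReal_le_envelope (m : ℕ) {y₁ y : ℝ} (hy₁ : 0 < y₁) (hy : y₁ ≤ y) :
    y ^ m * besselKReal m y ≤
      Real.sqrt (π / (2 * y₁)) * ladder m y₁ * y₁ ^ m * Real.exp (-y₁) * Real.exp (-(1 - m / y₁) * (y - y₁)) := by
  have hy0 : 0 < y := lt_of_lt_of_le hy₁ hy
  have hK := besselKReal_nat_le_ladder m hy0
  have hsq : Real.sqrt (π / (2 * y)) ≤ Real.sqrt (π / (2 * y₁)) :=
    Real.sqrt_le_sqrt (div_le_div_of_nonneg_left Real.pi_pos.le (by positivity) (by linarith))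
  have hlad := ladder_le_ladder m hy₁ hy
  have hpow : y ^ m ≤ y₁ ^ m * Real.exp ((m : ℝ) * (y / y₁ - 1)) := by
    have := div_pow_le_exp m hy0 hy₁
    rw [div_pow, div_le_iff₀ (pow_pos hy₁ m)] at this
    linarith
  have hexp : Real.exp ((m : ℝ) * (y / y₁ - 1)) * Real.exp (-y) = Real.exp (-y₁) * Real.exp (-(1 - m / y₁) * (y - y₁)) := by
    rw [← Real.exp_add, ← Real.exp_add]; congr 1; field_simp; ring
  calc y ^ m * besselKReal m y ≤ (y₁ ^ m * Real.exp ((m : ℝ) * (y / y₁ - 1))) * (Real.sqrt (π / (2 * y)) * Real.exp (-y) * ladder m y) :=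
        mul_le_mul hpow hK (besselKReal_pos _ hy0).le (by positivity)
    _ ≤ (y₁ ^ m * Real.exp ((m : ℝ) * (y / y₁ - 1))) * (Real.sqrt (π / (2 * y₁)) * Real.exp (-y) * ladder m y₁) := by
        refine mul_le_mul_of_nonneg_left ?_ (by positivity)
        exact mul_le_mul (mul_le_mul_of_nonneg_right hsq (Real.exp_pos _).le) hlad (ladder_pos m hy0).le (by positivity)
    _ = Real.sqrt (π / (2 * y₁)) * ladder m y₁ * y₁ ^ m * (Real.exp ((m : ℝ) * (y / y₁ - 1)) * Real.exp (-y)) := by ring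
    _ = _ := by rw [hexp]; ring

/-! ## §K3 Planar Gram geometry of the dual lattice: integer coordinates, the norm identity, comparison with `ℤ²` -/

section Gram

variable {V : Type*} [NormedAddCommGroup V] [InnerProductSpace ℝ V]

/-- The adjugate quadratic form `Q(z) = g₁₁ z₀² − 2 g₀₁ z₀ z₁ + g₀₀ z₁²` of a Gram matrix `[[g₀₀, g₀₁], [g₀₁, g₁₁]]`. -/
def gramQ (g00 g01 g11 : ℝ) (z : ℤ × ℤ) : ℝ := g11 * (z.1 : ℝ) ^ 2 - 2 * g01 * z.1 * z.2 + g00 * (z.2 : ℝ) ^ 2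

/-- ★ **Norm identity**: for `w` in the plane of `b₀, b₁`, `‖w‖² · (g₀₀ g₁₁ − g₀₁²) = Q(⟪w,b₀⟫, ⟪w,b₁⟫)`, i.e. `‖w‖² = zᵀ G⁻¹ z`
with `z = (⟪w, bᵢ⟫)ᵢ` (no independence needed). [folklore] -/
theorem norm_sq_mul_gramDet_eq (b : Fin 2 → V) {w : V} (hw : w ∈ Submodule.span ℝ (Set.range b)) :
    ‖w‖ ^ 2 * (‖b 0‖ ^ 2 * ‖b 1‖ ^ 2 - ⟪b 0, b 1⟫_ℝ ^ 2) =
      ‖b 1‖ ^ 2 * ⟪w, b 0⟫_ℝ ^ 2 - 2 * ⟪b 0, b 1⟫_ℝ * ⟪w, b 0⟫_ℝ * ⟪w, b 1⟫_ℝ + ‖b 0‖ ^ 2 * ⟪w, b 1⟫_ℝ ^ 2 := by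
  obtain ⟨c, rfl⟩ := (Submodule.mem_span_range_iff_exists_fun ℝ).1 hw
  simp only [Fin.sum_univ_two]
  rw [← real_inner_self_eq_norm_sq (c 0 • b 0 + c 1 • b 1), ← real_inner_self_eq_norm_sq (b 0), ← real_inner_self_eq_norm_sq (b 1)]
  simp only [inner_add_left, inner_add_right, inner_smul_left, inner_smul_right, conj_trivial]
  rw [real_inner_comm (b 0) (b 1)]
  ring

/-- In the plane, a vector orthogonal to both `b₀, b₁` vanishes. [folklore] -/
theorem eq_zero_of_inner_eq_zero (b : Fin 2 → V) {u : V} (hu : u ∈ Submodule.span ℝ (Set.range b)) (h0 : ⟪u, b 0⟫_ℝ = 0)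
    (h1 : ⟪u, b 1⟫_ℝ = 0) : u = 0 := by
  obtain ⟨c, rfl⟩ := (Submodule.mem_span_range_iff_exists_fun ℝ).1 hu
  simp only [Fin.sum_univ_two] at h0 h1 ⊢
  have : ⟪c 0 • b 0 + c 1 • b 1, c 0 • b 0 + c 1 • b 1⟫_ℝ = 0 := by
    rw [inner_add_right, inner_smul_right, inner_smul_right, h0, h1, mul_zero, mul_zero, add_zero]
  exact inner_self_eq_zero.1 this

/-- Injectivity of `w ↦ (⟪w, b₀⟫, ⟪w, b₁⟫)` on the plane. [folklore] -/
theorem eq_of_inner_eq (b : Fin 2 → V) {w w' : V} (hw : w ∈ Submodule.span ℝ (Set.range b)) (hw' : w' ∈ Submodule.span ℝ (Set.range b))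
    (h0 : ⟪w, b 0⟫_ℝ = ⟪w', b 0⟫_ℝ) (h1 : ⟪w, b 1⟫_ℝ = ⟪w', b 1⟫_ℝ) : w = w' := by
  have := eq_zero_of_inner_eq_zero b (Submodule.sub_mem _ hw hw') (by rw [inner_sub_left, h0, sub_self])
    (by rw [inner_sub_left, h1, sub_self])
  exact sub_eq_zero.1 this

/-- A dual-lattice vector has INTEGER pairings with `b₀, b₁`. [cite: Peikert2016, Def. 2.1.4] -/
theorem exists_int_inner_of_mem_dualLattice (b : Fin 2 → V) {w : V} (hw : w ∈ dualLattice (Submodule.span ℤ (Set.range b))) (i : Fin 2) :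
    ∃ n : ℤ, (n : ℝ) = ⟪w, b i⟫_ℝ :=
  mem_dualLattice.1 hw (b i) (Submodule.subset_span ⟨i, rfl⟩)

/-- The integer coordinates `(⟪w, b₀⟫, ⟪w, b₁⟫)` of a dual-lattice vector. -/
def dualCoord (b : Fin 2 → V) (w : dualLattice (Submodule.span ℤ (Set.range b))) : ℤ × ℤ :=
  ((exists_int_inner_of_mem_dualLattice b w.2 0).choose, (exists_int_inner_of_mem_dualLattice b w.2 1).choose)

/-- `dualCoord_fst` (docstring added by the landing lane; see the module docstring). [formal bookkeeping] -/
theorem dualCoord_fst (b : Fin 2 → V) (w : dualLattice (Submodule.span ℤ (Set.range b))) :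
    ((dualCoord b w).1 : ℝ) = ⟪(w : V), b 0⟫_ℝ :=
  (exists_int_inner_of_mem_dualLattice b w.2 0).choose_spec

/-- `dualCoord_snd` (docstring added by the landing lane; see the module docstring). [formal bookkeeping] -/
theorem dualCoord_snd (b : Fin 2 → V) (w : dualLattice (Submodule.span ℤ (Set.range b))) :
    ((dualCoord b w).2 : ℝ) = ⟪(w : V), b 1⟫_ℝ :=
  (exists_int_inner_of_mem_dualLattice b w.2 1).choose_spec

/-- The coordinate map is injective when `b₀, b₁` span the space. [this file] -/
theorem dualCoord_injective (b : Fin 2 → V) (hspan : ∀ v : V, v ∈ Submodule.span ℝ (Set.range b)) :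
    Function.Injective (dualCoord b) := by
  intro w w' h
  have h0 : ⟪(w : V), b 0⟫_ℝ = ⟪(w' : V), b 0⟫_ℝ := by rw [← dualCoord_fst, ← dualCoord_fst, h]
  have h1 : ⟪(w : V), b 1⟫_ℝ = ⟪(w' : V), b 1⟫_ℝ := by rw [← dualCoord_snd, ← dualCoord_snd, h]
  exact Subtype.ext (eq_of_inner_eq b (hspan _) (hspan _) h0 h1)

/-- ★ **Comparison with `ℤ²`**: any family on the dual lattice of `ℤb₀ + ℤb₁` (with `b₀, b₁` spanning the plane) is summed
below any nonnegative summable majorant on `ℤ²` that dominates it through the integer coordinates `z = (⟪w,b₀⟫, ⟪w,b₁⟫)`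
(for which `‖w‖²·det G = Q(z)`, `norm_sq_mul_gramDet_eq`).  No summability or sign of the family is required (a non-summable
`tsum` is `0`).
[this file] -/
theorem tsum_dualLattice_le_of_majorant (b : Fin 2 → V) (hspan : ∀ v : V, v ∈ Submodule.span ℝ (Set.range b))
    (F : V → ℝ) {G : ℤ × ℤ → ℝ} (hG0 : ∀ z, 0 ≤ G z) (hG : Summable G)
    (hdom : ∀ (w : V) (z : ℤ × ℤ), w ∈ dualLattice (Submodule.span ℤ (Set.range b)) →
      (z.1 : ℝ) = ⟪w, b 0⟫_ℝ → (z.2 : ℝ) = ⟪w, b 1⟫_ℝ → F w ≤ G z) :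
    ∑' w : dualLattice (Submodule.span ℤ (Set.range b)), F (w : V) ≤ ∑' z : ℤ × ℤ, G z := by
  by_cases hs : Summable fun w : dualLattice (Submodule.span ℤ (Set.range b)) => F (w : V)
  · exact Summable.tsum_le_tsum_of_inj (dualCoord b) (dualCoord_injective b hspan) (fun z _ => hG0 z)
      (fun w => hdom w (dualCoord b w) w.2 (dualCoord_fst b w) (dualCoord_snd b w)) hs hG
  · rw [tsum_eq_zero_of_not_summable hs]
    exact tsum_nonneg hG0

end Gram

end Summit.AtomisticToContinuum.Crystallization.Theorems.OverbindingBudgetAffineFarSmoothSplit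

end
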